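import Summits.BirchSwinnertonDyer.BirchSwinnertonDyer.Theorems.EisensteinDepletionAtTwoStarOptBNSFNsfReduction
import HarnessLib

/-!
# Line `star` on crux E1M (stmt-BirchSwinnertonDyer-20341): the squarefree residue `stub_starOptBSF` from TWO POSITION LAWS of the optimal curve
# (print-free door, complementary to the odd-Shimura-index door `SfOddCover`)

Lead star-p1 GEN 15.  The census of the GEN 15 memo (Cruxes/DepletedLambdaLawAtTwoMod/Lines/star-sf-residue-gen15.md; Cremona, odd squarefree
`N < 5·10⁵`) shows two laws about the `X₀(N)`-lattice-optimal curve `W₀`: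
* (T1) «OPTIMAL IS NEVER OF TYPE A» (good ordinary at 2, any level): if `W₀` has a unique rational 2-torsion abscissa and it is ramified at 2, then it
  is odd (odd squarefree: 0 / 38 258, the 90 ramified cases being the prime-level MID curves `X₀(17)`, Neumann–Setzer; odd non-squarefree: vacuous,
  the optimal curve is never ramified there, P-E₀ 0 / 44 690);
* (T2) «OPTIMAL IS NEVER IN PROP. 5.13'S CONFIGURATION INSIDE A HABITAT CLASS, `N ≠ 15`»: no rational 2-torsion abscissa of `W₀` is both
  ramified at 2 and odd (0 / 20 577 habitat classes; `15a1` is the exception at the excluded level).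
THIS FILE: v6's research stub `stub_starOptBSF` (StarOptB at squarefree `N ≠ 15`, ANY Shimura index) follows from (T1) ∧ (T2) with NO print fact:
if `W₀` has no ramified rational abscissa, regime transport (`NsfReduction.regimeTransport`); if it has one, `x_f`, then by (T2) `x_f` is not odd, by
(T1) the rational 2-torsion is not unique, and the elementary `exists_odd_etale_of_two_rat` (Vieta's third root + «at most one rational abscissa is
ramified») produces an odd étale rational abscissa.  So the whole squarefree residue of E1M is the conjunction of two POSITION statements about optimal
curves (both open in print; (T1)/(T2) are what a Shimura-subgroup / cuspidal-group argument at composite level should deliver).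
CONDITIONAL on (T1), (T2) (stated inline, verbatim research statements); no `sorry`, no new definition; nothing here reads `r_an`; BSD is NOT proved.
-/

set_option linter.dupNamespace false
set_option autoImplicit false

noncomputable section

open scoped Classical
open WeierstrassCurve Literature.NumberTheory.EllipticCurves Literature.NumberTheory.EllipticCurves.Greenberg1999
open Literature.NumberTheory.EllipticCurves.ModularForms
open Summit.BirchSwinnertonDyer.BirchSwinnertonDyer.Theorems.DepletionAtTwo

namespace Summit.BirchSwinnertonDyer.BirchSwinnertonDyer.Theorems.DepletionAtTwo.SfPositions

/-! ### Real roots of the 2-division cubic with two known roots -/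

/-- **Vieta for the 2-division cubic over `ℝ`.**  If `a ≠ b` are real roots of `s(r) = 4r³ + b₂r² + 2b₄r + b₆`, then every real root is
`a`, `b` or `c = −b₂/4 − a − b`, and `c` is a root. [folklore] -/
theorem root_cases_of_two_roots {b₂ b₄ b₆ a b : ℝ} (hab : a ≠ b)
    (ha : 4 * a ^ 3 + b₂ * a ^ 2 + 2 * b₄ * a + b₆ = 0) (hb : 4 * b ^ 3 + b₂ * b ^ 2 + 2 * b₄ * b + b₆ = 0) :
    (4 * (-b₂ / 4 - a - b) ^ 3 + b₂ * (-b₂ / 4 - a - b) ^ 2 + 2 * b₄ * (-b₂ / 4 - a - b) + b₆ = 0) ∧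
    ∀ r : ℝ, 4 * r ^ 3 + b₂ * r ^ 2 + 2 * b₄ * r + b₆ = 0 → r = a ∨ r = b ∨ r = -b₂ / 4 - a - b := by
  -- the symmetric quotient `Q = (s(a) − s(b))/(a − b)`
  have hQ : 4 * (a ^ 2 + a * b + b ^ 2) + b₂ * (a + b) + 2 * b₄ = 0 := by
    have h : (a - b) * (4 * (a ^ 2 + a * b + b ^ 2) + b₂ * (a + b) + 2 * b₄) = 0 := by linear_combination ha - hb
    exact (mul_eq_zero.mp h).resolve_left (sub_ne_zero.mpr hab)
  -- the factorisation `s(r) = 4(r − a)(r − b)(r − c)`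
  have hfac : ∀ r : ℝ, 4 * r ^ 3 + b₂ * r ^ 2 + 2 * b₄ * r + b₆ = 4 * (r - a) * (r - b) * (r - (-b₂ / 4 - a - b)) := by
    intro r
    linear_combination (r - a) * hQ + ha
  refine ⟨?_, fun r hr ↦ ?_⟩
  · rw [hfac]; ring
  · rw [hfac] at hr
    rcases mul_eq_zero.mp hr with h | h
    · rcases mul_eq_zero.mp h with h' | h'
      · left; have : (4 : ℝ) ≠ 0 := by norm_num
        exact sub_eq_zero.mp ((mul_eq_zero.mp h').resolve_left this)
      · exact Or.inr (Or.inl (sub_eq_zero.mp h'))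
    · exact Or.inr (Or.inr (sub_eq_zero.mp h))

/-- A root of the 2-division cubic over `ℚ` is a rational 2-torsion abscissa (with `y = −(a₁x + a₃)/2`). [cite: SilvermanAEC2009, III.2.3 (ψ₂)] -/
theorem hasRationalTwoTorsionX_of_cubic (W : WeierstrassCurve ℚ) {x : ℚ}
    (h : 4 * x ^ 3 + W.b₂ * x ^ 2 + 2 * W.b₄ * x + W.b₆ = 0) : HasRationalTwoTorsionX W x := by
  refine ⟨-(W.a₁ * x + W.a₃) / 2, ?_, by ring⟩
  rw [WeierstrassCurve.Affine.equation_iff]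
  simp only [WeierstrassCurve.b₂, WeierstrassCurve.b₄, WeierstrassCurve.b₆] at h
  linear_combination (-1 / 4 : ℚ) * h

/-- **Two rational abscissas, one ramified and even ⇒ an odd étale rational abscissa.**  `W/ℚ` globally minimal with good reduction at 2; `a ≠ b`
rational 2-torsion abscissas with `a` ramified at 2 and NOT odd.  Then `W` has a rational 2-torsion abscissa that is odd and not ramified: either `b`
(if odd; it is not ramified since `a` is — `TwoAdic.not_twoTorsionRamifiedAtTwo_and_rat`) or Vieta's third root `c = −b₂/4 − a − b` (if `b` is not odd
either, `c` is the least real root). [cite: GreenbergLNM1716, §5 Remark (p. 121)] [cite: SilvermanAEC2009, III.2.3] -/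
theorem exists_odd_etale_of_two_rat (W : WeierstrassCurve ℚ) [W.IsGloballyMinimal] (hgood : W.HasGoodReductionAtPrime 2)
    {a b : ℚ} (ha : HasRationalTwoTorsionX W a) (hb : HasRationalTwoTorsionX W b) (hab : a ≠ b)
    (hRa : TwoTorsionRamifiedAtTwo a) (hOa : ¬ TwoTorsionOdd W a) :
    ∃ x₀ : ℚ, HasRationalTwoTorsionX W x₀ ∧ TwoTorsionOdd W x₀ ∧ ¬ TwoTorsionRamifiedAtTwo x₀ := by
  have hnotR : ∀ {c : ℚ}, HasRationalTwoTorsionX W c → c ≠ a → ¬ TwoTorsionRamifiedAtTwo c := fun hc hca hRc ↦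
    TwoAdic.not_twoTorsionRamifiedAtTwo_and_rat W hgood hc ha hca ⟨hRc, hRa⟩
  by_cases hOb : TwoTorsionOdd W b
  · exact ⟨b, hb, hOb, hnotR hb (Ne.symm hab)⟩
  -- the third root
  obtain ⟨ya, hPa, hta⟩ := ha
  obtain ⟨yb, hPb, htb⟩ := hb
  have sa := fourXCubed_add_eq_zero_of_twoTorsion hPa hta
  have sb := fourXCubed_add_eq_zero_of_twoTorsion hPb htb
  have saR := fourXCubed_add_eq_zero_of_twoTorsion_real hPa hta
  have sbR := fourXCubed_add_eq_zero_of_twoTorsion_real hPb htb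
  have habR : (a : ℝ) ≠ (b : ℝ) := by exact_mod_cast hab
  obtain ⟨-, hroots⟩ := root_cases_of_two_roots habR saR sbR
  set c : ℚ := -W.b₂ / 4 - a - b with hc
  have hcR : ((c : ℚ) : ℝ) = -(W.b₂ : ℝ) / 4 - a - b := by rw [hc]; push_cast; ring
  -- `c` is a rational root
  have sc : 4 * c ^ 3 + W.b₂ * c ^ 2 + 2 * W.b₄ * c + W.b₆ = 0 := by
    have hQ : 4 * (a ^ 2 + a * b + b ^ 2) + W.b₂ * (a + b) + 2 * W.b₄ = 0 := by
      have h : (a - b) * (4 * (a ^ 2 + a * b + b ^ 2) + W.b₂ * (a + b) + 2 * W.b₄) = 0 := by linear_combination sa - sb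
      exact (mul_eq_zero.mp h).resolve_left (sub_ne_zero.mpr hab)
    rw [hc]
    linear_combination (-W.b₂ / 4 - a - b - a) * hQ + sa
  have hcX : HasRationalTwoTorsionX W c := hasRationalTwoTorsionX_of_cubic W sc
  -- `a` and `b` are not least: there are roots below them, necessarily among `{a, b, c}`
  have ha' : HasRationalTwoTorsionX W a := ⟨ya, hPa, hta⟩
  have hb' : HasRationalTwoTorsionX W b := ⟨yb, hPb, htb⟩
  rw [twoTorsionOdd_iff] at hOa hOb
  push Not at hOa hOb
  obtain ⟨r₁, hr₁, hr₁a⟩ := hOa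
  obtain ⟨r₂, hr₂, hr₂b⟩ := hOb
  have hcases₁ := hroots r₁ hr₁
  have hcases₂ := hroots r₂ hr₂
  -- `c` is the least root
  have hcle : ∀ r : ℝ, 4 * r ^ 3 + (W.b₂ : ℝ) * r ^ 2 + 2 * (W.b₄ : ℝ) * r + (W.b₆ : ℝ) = 0 → ((c : ℚ) : ℝ) ≤ r := by
    intro r hr
    rw [hcR]
    rcases hroots r hr with rfl | rfl | rfl
    · -- r = a
      rcases hcases₁ with h | h | h
      · exact absurd h (ne_of_lt hr₁a)
      · rcases hcases₂ with h2 | h2 | h2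
        · rw [h] at hr₁a; rw [h2] at hr₂b; exact absurd (hr₁a.trans hr₂b) (lt_irrefl _)
        · exact absurd h2 (ne_of_lt hr₂b)
        · rw [h2] at hr₂b; rw [h] at hr₁a; exact le_of_lt (hr₂b.trans hr₁a)
      · rw [h] at hr₁a; exact le_of_lt hr₁a
    · -- r = b
      rcases hcases₂ with h2 | h2 | h2
      · rcases hcases₁ with h | h | h
        · exact absurd h (ne_of_lt hr₁a)
        · rw [h] at hr₁a; rw [h2] at hr₂b; exact absurd (hr₁a.trans hr₂b) (lt_irrefl _)
        · rw [h] at hr₁a; rw [h2] at hr₂b; exact le_of_lt (hr₁a.trans hr₂b)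
      · exact absurd h2 (ne_of_lt hr₂b)
      · rw [h2] at hr₂b; exact le_of_lt hr₂b
    · exact le_rfl
  have hOc : TwoTorsionOdd W c := (twoTorsionOdd_iff W c).mpr hcle
  have hca : c ≠ a := by
    rintro h
    apply (show ¬ TwoTorsionOdd W a from fun hO ↦ ?_) (h ▸ hOc)
    exact absurd (hO r₁ hr₁) (not_le.mpr hr₁a)
  exact ⟨c, hcX, hOc, hnotR hcX hca⟩

/-! ### The squarefree residue from the two position laws -/

/-- **`stub_starOptBSF` (v6: StarOptB at squarefree `N ≠ 15`, every Shimura index) FROM THE TWO POSITION LAWS, print-free.**  Hypotheses, stated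
inline: (T1) «the `X₀(N)`-lattice-optimal curve (good ordinary at 2) is never of type A» (unique rational 2-torsion + ramified ⇒ odd) and (T2) «in a
habitat class at squarefree `N ≠ 15` the optimal curve has no rational 2-torsion abscissa that is ramified AND odd».  Proof: no ramified rational
abscissa on `W₀` ⇒ `NsfReduction.regimeTransport`; a ramified one `x_f` ⇒ not odd (T2) ⇒ the rational 2-torsion is not unique (T1) ⇒
`exists_odd_etale_of_two_rat`.  CONDITIONAL on (T1), (T2) — both open in print (0 failures, Cremona N < 5·10⁵).
[cite: GreenbergLNM1716, §5 Props. 5.13–5.14 (pp. 120–121)] [cite: Stevens1989, §2] -/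
theorem starOptBSF_of_positions
    (hT1 : ∀ (W₀ : WeierstrassCurve ℚ) [W₀.IsElliptic] [W₀.IsGloballyMinimal]
      ⦃N : ℕ⦄ [NeZero N] (f : CuspForm (CongruenceSubgroup.Gamma0 N) 2), IsNewformOf W₀ f → IsOrdinaryAt W₀ 2 →
      ∀ (L₀ : PeriodPair), IsNeronLatticeOf (W₀.baseChange ℂ) L₀ → ∀ (q : ℚ), q ≠ 0 →
      (∀ z ∈ periodLattice f, (q : ℂ) * z ∈ L₀.lattice) → (∀ z ∈ L₀.lattice, ∃ w ∈ periodLattice f, z = (q : ℂ) * w) →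
      ∀ (x₀ : ℚ), HasUniqueRationalTwoTorsionX W₀ x₀ → TwoTorsionRamifiedAtTwo x₀ → TwoTorsionOdd W₀ x₀)
    (hT2 : ∀ (W : WeierstrassCurve ℚ) [W.IsElliptic] [W.IsGloballyMinimal] (x : ℚ), IsOrdinaryAt W 2 →
      HasUniqueRationalTwoTorsionX W x →
      ((TwoTorsionRamifiedAtTwo x ∧ ¬ TwoTorsionOdd W x) ∨ (TwoTorsionOdd W x ∧ ¬ TwoTorsionRamifiedAtTwo x)) →
      W.conductorNorm ℤ ≠ 15 → Squarefree (W.conductorNorm ℤ) →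
      ∀ ⦃N : ℕ⦄ [NeZero N] (f : CuspForm (CongruenceSubgroup.Gamma0 N) 2), IsNewformOf W f →
      ∀ (W₀ : WeierstrassCurve ℚ) [W₀.IsElliptic] [W₀.IsGloballyMinimal], IsNewformOf W₀ f →
      ∀ (L₀ : PeriodPair), IsNeronLatticeOf (W₀.baseChange ℂ) L₀ → ∀ (q : ℚ), q ≠ 0 →
      (∀ z ∈ periodLattice f, (q : ℂ) * z ∈ L₀.lattice) → (∀ z ∈ L₀.lattice, ∃ w ∈ periodLattice f, z = (q : ℂ) * w) →
      ∀ (x₀ : ℚ), HasRationalTwoTorsionX W₀ x₀ → TwoTorsionRamifiedAtTwo x₀ → ¬ TwoTorsionOdd W₀ x₀) :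
    ∀ (W : WeierstrassCurve ℚ) [W.IsElliptic] [W.IsGloballyMinimal] (x : ℚ), IsOrdinaryAt W 2 →
      HasUniqueRationalTwoTorsionX W x →
      ((TwoTorsionRamifiedAtTwo x ∧ ¬ TwoTorsionOdd W x) ∨ (TwoTorsionOdd W x ∧ ¬ TwoTorsionRamifiedAtTwo x)) →
      W.conductorNorm ℤ ≠ 15 → Squarefree (W.conductorNorm ℤ) →
      ∀ ⦃N : ℕ⦄ [NeZero N] (f : CuspForm (CongruenceSubgroup.Gamma0 N) 2), IsNewformOf W f →
      ∀ (W₀ : WeierstrassCurve ℚ) [W₀.IsElliptic] [W₀.IsGloballyMinimal], IsNewformOf W₀ f →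
      ∀ (L₀ : PeriodPair), IsNeronLatticeOf (W₀.baseChange ℂ) L₀ → ∀ (q : ℚ), q ≠ 0 →
      (∀ z ∈ periodLattice f, (q : ℂ) * z ∈ L₀.lattice) → (∀ z ∈ L₀.lattice, ∃ w ∈ periodLattice f, z = (q : ℂ) * w) →
      ∃ x₀ : ℚ, HasRationalTwoTorsionX W₀ x₀ ∧ TwoTorsionOdd W₀ x₀ ∧ ¬ TwoTorsionRamifiedAtTwo x₀ := by
  intro W _ _ x hord hux htype h15 hsf N _ f hW W₀ _ _ hW₀ L₀ hL₀ q hq hin hout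
  have hiso : WeierstrassCurve.IsIsogenous W W₀ :=
    IsNewformOf.isIsogenous WeierstrassCurve.isIsogenous_iff_frobeniusTrace_eq_holds hW hW₀
  have hord₀ : IsOrdinaryAt W₀ 2 :=
    Summit.BirchSwinnertonDyer.BirchSwinnertonDyer.Theorems.IsogenyMuShift.isOrdinaryAt_of_isIsogenous hiso hord
  by_cases hno : ∃ x₀ : ℚ, HasRationalTwoTorsionX W₀ x₀ ∧ TwoTorsionRamifiedAtTwo x₀
  · obtain ⟨xf, hxf, hRf⟩ := hno
    -- (T2): the ramified abscissa is not odd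
    have hOf : ¬ TwoTorsionOdd W₀ xf := hT2 W x hord hux htype h15 hsf f hW W₀ hW₀ L₀ hL₀ q hq hin hout xf hxf hRf
    -- (T1): hence the rational 2-torsion of `W₀` is not unique
    have hnu : ¬ HasUniqueRationalTwoTorsionX W₀ xf := fun hu ↦ hOf (hT1 W₀ f hW₀ hord₀ L₀ hL₀ q hq hin hout xf hu hRf)
    have hother : ∃ b : ℚ, HasRationalTwoTorsionX W₀ b ∧ b ≠ xf := by
      by_contra hcon
      push Not at hcon
      exact hnu ⟨hxf, fun z hz ↦ hcon z hz⟩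
    obtain ⟨b, hb, hbf⟩ := hother
    exact exists_odd_etale_of_two_rat W₀ hord₀.1 hxf hb (Ne.symm hbf) hRf hOf
  · exact NsfReduction.regimeTransport W x hord hux htype W₀ hiso hno

end Summit.BirchSwinnertonDyer.BirchSwinnertonDyer.Theorems.DepletionAtTwo.SfPositions

end
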